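import Summits.NavierStokesRegularity.FunctionalMining.NoGo.LogDoorExpansion
import Mathlib.Analysis.Calculus.ContDiff.Bounds
import HarnessLib

/-!
# Sup-norm calculus for planted witnesses: `Δ`, `∇Δ`, `Δ²` against iterated derivatives

Search for candidate a priori estimates; no regularity claim. NS FUNCTIONAL MINING — NO-GO BRANCH
(cell `pub-nsfunc`, prove seat gen 4). Generic bookkeeping used to make the no-go N6 witness
QUANTITATIVE (the log-door threshold, `NoGo/PalinstrophyLogThresholdWeak.lean`): for a smooth
field `f` on `ℝ³`,
* `norm_iteratedFDeriv_laplacian_le`: `‖Dᵏ(Δf)(x)‖ ≤ 3 ‖Dᵏ⁺²f(x)‖`, hence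
  `‖Δf(x)‖ ≤ 3‖D²f(x)‖`, `‖D(Δf)(x)‖ ≤ 3‖D³f(x)‖`, `‖Δ²f(x)‖ ≤ 9‖D⁴f(x)‖`;
* `norm_fderiv_apply_self_le`: `‖Df(x)(f x)‖ ≤ ‖D¹f(x)‖ ‖f x‖`;
* integrals of functions vanishing off a compact set against sup bounds
  (`integral_le_of_le_of_tsupport`, `abs_integral_le_of_tsupport`).
Folklore calculus (Mathlib `iteratedFDeriv` API); nothing is asserted about Navier–Stokes.
-/

noncomputable section

open MeasureTheory Set Function Filter
open scoped ContDiff Topology Laplacian InnerProductSpace RealInnerProductSpace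

namespace Summit.NavierStokesRegularity.FunctionalMining

namespace Sep3

open Literature.Analysis.FluidPDE

/-- `k ≤ ∞` in `WithTop ℕ∞` for a natural number `k`. [folklore] -/
private theorem natCast_le_infty (k : ℕ) : (k : WithTop ℕ∞) ≤ ∞ := by exact_mod_cast le_top

section Laplacian

variable {F : Type*} [NormedAddCommGroup F] [NormedSpace ℝ F] {f : E3 → F}

/-- `‖Dᵏ(y ↦ D²f(y)(a,b))(x)‖ ≤ ‖a‖ ‖b‖ ‖Dᵏ⁺²f(x)‖`. [folklore] -/
theorem norm_iteratedFDeriv_fderiv_fderiv_apply_le (hf : ContDiff ℝ ∞ f) (a b : E3) (k : ℕ) (x : E3) :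
    ‖iteratedFDeriv ℝ k (fun y => fderiv ℝ (fderiv ℝ f) y a b) x‖ ≤
      ‖a‖ * ‖b‖ * ‖iteratedFDeriv ℝ (k + 2) f x‖ := by
  have h1 : ContDiff ℝ ∞ (fderiv ℝ f) := hf.fderiv_right (m := ∞) le_rfl
  have h2 : ContDiff ℝ ∞ (fderiv ℝ (fderiv ℝ f)) := h1.fderiv_right (m := ∞) le_rfl
  have h2a : ContDiff ℝ ∞ (fun y => fderiv ℝ (fderiv ℝ f) y a) := h2.clm_apply contDiff_const
  calc ‖iteratedFDeriv ℝ k (fun y => fderiv ℝ (fderiv ℝ f) y a b) x‖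
      ≤ ‖b‖ * ‖iteratedFDeriv ℝ k (fun y => fderiv ℝ (fderiv ℝ f) y a) x‖ :=
        norm_iteratedFDeriv_clm_apply_const h2a.contDiffAt (natCast_le_infty k)
    _ ≤ ‖b‖ * (‖a‖ * ‖iteratedFDeriv ℝ k (fderiv ℝ (fderiv ℝ f)) x‖) := by
        gcongr
        exact norm_iteratedFDeriv_clm_apply_const h2.contDiffAt (natCast_le_infty k)
    _ = ‖a‖ * ‖b‖ * ‖iteratedFDeriv ℝ (k + 2) f x‖ := by
        rw [norm_iteratedFDeriv_fderiv, norm_iteratedFDeriv_fderiv]; ring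

/-- The Laplacian on `ℝ³` as the sum of the three second coordinate derivatives, function level.
[folklore] -/
theorem laplacian_eq_sum_basisFun (f : E3 → F) :
    Δ f = fun y => ∑ i : Fin 3, fderiv ℝ (fderiv ℝ f) y (EuclideanSpace.basisFun (Fin 3) ℝ i)
      (EuclideanSpace.basisFun (Fin 3) ℝ i) := by
  rw [InnerProductSpace.laplacian_eq_iteratedFDeriv_orthonormalBasis f (EuclideanSpace.basisFun (Fin 3) ℝ)]
  funext y
  refine Finset.sum_congr rfl fun i _ => ?_
  rw [iteratedFDeriv_two_apply]
  rfl

/-- **`‖Dᵏ(Δf)(x)‖ ≤ 3 ‖Dᵏ⁺²f(x)‖`** on `ℝ³`. [folklore] -/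
theorem norm_iteratedFDeriv_laplacian_le (hf : ContDiff ℝ ∞ f) (k : ℕ) (x : E3) :
    ‖iteratedFDeriv ℝ k (Δ f) x‖ ≤ 3 * ‖iteratedFDeriv ℝ (k + 2) f x‖ := by
  have h1 : ContDiff ℝ ∞ (fderiv ℝ f) := hf.fderiv_right (m := ∞) le_rfl
  have h2 : ContDiff ℝ ∞ (fderiv ℝ (fderiv ℝ f)) := h1.fderiv_right (m := ∞) le_rfl
  set e : Fin 3 → E3 := fun i => EuclideanSpace.basisFun (Fin 3) ℝ i with he
  have hei : ∀ i, ‖e i‖ = 1 := fun i => by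
    simp [he, EuclideanSpace.basisFun_apply]
  have hs : ∀ i, ContDiff ℝ ∞ (fun y => fderiv ℝ (fderiv ℝ f) y (e i) (e i)) := fun i =>
    (h2.clm_apply contDiff_const).clm_apply contDiff_const
  rw [laplacian_eq_sum_basisFun f]
  calc ‖iteratedFDeriv ℝ k (fun y => ∑ i : Fin 3, fderiv ℝ (fderiv ℝ f) y (e i) (e i)) x‖
      = ‖∑ i : Fin 3, iteratedFDeriv ℝ k (fun y => fderiv ℝ (fderiv ℝ f) y (e i) (e i)) x‖ := by
        rw [iteratedFDeriv_sum (fun i _ => (hs i).of_le (natCast_le_infty k))]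
        simp only [Finset.sum_apply]
    _ ≤ ∑ i : Fin 3, ‖iteratedFDeriv ℝ k (fun y => fderiv ℝ (fderiv ℝ f) y (e i) (e i)) x‖ :=
        norm_sum_le _ _
    _ ≤ ∑ i : Fin 3, ‖e i‖ * ‖e i‖ * ‖iteratedFDeriv ℝ (k + 2) f x‖ :=
        Finset.sum_le_sum fun i _ => norm_iteratedFDeriv_fderiv_fderiv_apply_le hf _ _ k x
    _ = 3 * ‖iteratedFDeriv ℝ (k + 2) f x‖ := by
        simp only [hei, one_mul, Finset.sum_const, Finset.card_univ, Fintype.card_fin, nsmul_eq_mul,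
          Nat.cast_ofNat]

/-- `‖Δf(x)‖ ≤ 3 ‖D²f(x)‖`. [folklore] -/
theorem norm_laplacian_le (hf : ContDiff ℝ ∞ f) (x : E3) : ‖Δ f x‖ ≤ 3 * ‖iteratedFDeriv ℝ 2 f x‖ := by
  have h := norm_iteratedFDeriv_laplacian_le hf 0 x
  rwa [norm_iteratedFDeriv_zero] at h

/-- `‖D(Δf)(x)‖ ≤ 3 ‖D³f(x)‖`. [folklore] -/
theorem norm_fderiv_laplacian_le (hf : ContDiff ℝ ∞ f) (x : E3) :
    ‖fderiv ℝ (Δ f) x‖ ≤ 3 * ‖iteratedFDeriv ℝ 3 f x‖ := by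
  have h := norm_iteratedFDeriv_laplacian_le hf 1 x
  rwa [norm_iteratedFDeriv_one] at h

/-- `Δf` is smooth when `f` is (any normed target). [folklore] -/
theorem contDiff_laplacian (hf : ContDiff ℝ ∞ f) : ContDiff ℝ ∞ (Δ f) := by
  have h1 : ContDiff ℝ ∞ (fderiv ℝ f) := hf.fderiv_right (m := ∞) le_rfl
  have h2 : ContDiff ℝ ∞ (fderiv ℝ (fderiv ℝ f)) := h1.fderiv_right (m := ∞) le_rfl
  rw [laplacian_eq_sum_basisFun f]
  exact ContDiff.sum fun i _ => (h2.clm_apply contDiff_const).clm_apply contDiff_const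

/-- `‖Δ²f(x)‖ ≤ 9 ‖D⁴f(x)‖`. [folklore] -/
theorem norm_laplacian2_le (hf : ContDiff ℝ ∞ f) (x : E3) :
    ‖Δ (Δ f) x‖ ≤ 9 * ‖iteratedFDeriv ℝ 4 f x‖ := by
  calc ‖Δ (Δ f) x‖ ≤ 3 * ‖iteratedFDeriv ℝ 2 (Δ f) x‖ := norm_laplacian_le (contDiff_laplacian hf) x
    _ ≤ 3 * (3 * ‖iteratedFDeriv ℝ 4 f x‖) := by
        gcongr; exact norm_iteratedFDeriv_laplacian_le hf 2 x
    _ = 9 * ‖iteratedFDeriv ℝ 4 f x‖ := by ring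

/-- `Σᵢ ‖D(Δf)(x) eᵢ‖² ≤ 27 ‖D³f(x)‖²`. [folklore] -/
theorem sum_norm_fderiv_laplacian_sq_le (hf : ContDiff ℝ ∞ f) (x : E3) :
    ∑ i : Fin 3, ‖fderiv ℝ (Δ f) x (EuclideanSpace.single i 1)‖ ^ 2 ≤
      27 * ‖iteratedFDeriv ℝ 3 f x‖ ^ 2 := by
  have h := norm_fderiv_laplacian_le hf x
  have hi : ∀ i : Fin 3, ‖fderiv ℝ (Δ f) x (EuclideanSpace.single i 1)‖ ^ 2 ≤
      (3 * ‖iteratedFDeriv ℝ 3 f x‖) ^ 2 := by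
    intro i
    have h1 : ‖fderiv ℝ (Δ f) x (EuclideanSpace.single i 1)‖ ≤ ‖fderiv ℝ (Δ f) x‖ := by
      simpa using (fderiv ℝ (Δ f) x).le_opNorm (EuclideanSpace.single i (1 : ℝ))
    exact pow_le_pow_left₀ (norm_nonneg _) (h1.trans h) 2
  calc ∑ i : Fin 3, ‖fderiv ℝ (Δ f) x (EuclideanSpace.single i 1)‖ ^ 2
      ≤ ∑ _i : Fin 3, (3 * ‖iteratedFDeriv ℝ 3 f x‖) ^ 2 := Finset.sum_le_sum fun i _ => hi i
    _ = 27 * ‖iteratedFDeriv ℝ 3 f x‖ ^ 2 := by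
        simp only [Finset.sum_const, Finset.card_univ, Fintype.card_fin, nsmul_eq_mul, Nat.cast_ofNat]; ring

end Laplacian

/-! ## Uniform bounds for compactly supported smooth functions -/

section Bounds

variable {F : Type*} [NormedAddCommGroup F] [NormedSpace ℝ F]

/-- All derivatives of a compactly supported smooth function are bounded. [folklore] -/
theorem exists_bound_iteratedFDeriv_of_hasCompactSupport {g : E3 → F} (hg : ContDiff ℝ ∞ g)
    (hc : HasCompactSupport g) (k : ℕ) : ∃ C, 0 ≤ C ∧ ∀ x, ‖iteratedFDeriv ℝ k g x‖ ≤ C := by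
  obtain ⟨C, hC⟩ := (hg.continuous_iteratedFDeriv (natCast_le_infty k)).bounded_above_of_compact_support
    (hc.iteratedFDeriv k)
  exact ⟨max C 0, le_max_right _ _, fun x => (hC x).trans (le_max_left _ _)⟩

/-- Off the topological support every derivative vanishes. [folklore] -/
theorem iteratedFDeriv_eq_zero_of_notMem_tsupport {g : E3 → F} {x : E3} (hx : x ∉ tsupport g) (k : ℕ) :
    iteratedFDeriv ℝ k g x = 0 :=
  image_eq_zero_of_notMem_tsupport fun h => hx (tsupport_iteratedFDeriv_subset k h)

/-- `tsupport (Δ v) ⊆ tsupport v`. [folklore] -/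
theorem tsupport_laplacian_subset' (v : E3 → E3) : tsupport (Δ v) ⊆ tsupport v :=
  closure_minimal (fun _ hy => by_contra fun h => hy (laplacian_eq_zero_of_notMem_tsupport h))
    (isClosed_tsupport v)

end Bounds

/-! ## Integrals of bounded functions vanishing off a ball -/

section Integrals

/-- The volume of the closed ball `B̄(0,R) ⊆ ℝ³`, as a real number. [folklore] -/
def volBall (R : ℝ) : ℝ := (volume (Metric.closedBall (0 : E3) R)).toReal

/-- `0 ≤ volBall R`. [folklore] -/
theorem volBall_nonneg (R : ℝ) : 0 ≤ volBall R := ENNReal.toReal_nonneg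

/-- `∫ φ ≤ S · |B̄(0,R)|` for `0 ≤ φ ≤ S` vanishing off `B̄(0,R)`. [folklore] -/
theorem integral_le_of_le_of_ball {φ : E3 → ℝ} {S R : ℝ} (h0 : ∀ y, 0 ≤ φ y) (hS : ∀ y, φ y ≤ S)
    (hR : ∀ y, R < ‖y‖ → φ y = 0) : ∫ y, φ y ≤ S * volBall R := by
  have hSnn : 0 ≤ S := (h0 0).trans (hS 0)
  have hle : ∀ y, φ y ≤ (Metric.closedBall (0 : E3) R).indicator (fun _ => S) y := by
    intro y
    by_cases hy : y ∈ Metric.closedBall (0 : E3) R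
    · rw [indicator_of_mem hy]; exact hS y
    · rw [indicator_of_notMem hy, hR y (by simpa using hy)]
  have hint : Integrable ((Metric.closedBall (0 : E3) R).indicator fun _ => S) volume :=
    (integrable_indicator_iff measurableSet_closedBall).2
      (integrableOn_const ((isCompact_closedBall (0 : E3) R).measure_lt_top.ne))
  calc ∫ y, φ y ≤ ∫ y, (Metric.closedBall (0 : E3) R).indicator (fun _ => S) y :=
        integral_mono_of_nonneg (ae_of_all _ h0) hint (ae_of_all _ hle)
    _ = S * volBall R := by
        rw [integral_indicator_const S measurableSet_closedBall, volBall, smul_eq_mul, mul_comm]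
        rfl

/-- `|∫ ψ| ≤ S · |B̄(0,R)|` for `|ψ| ≤ S` vanishing off `B̄(0,R)`. [folklore] -/
theorem abs_integral_le_of_ball {ψ : E3 → ℝ} {S R : ℝ} (hS : ∀ y, |ψ y| ≤ S)
    (hR : ∀ y, R < ‖y‖ → ψ y = 0) : |∫ y, ψ y| ≤ S * volBall R := by
  have hle : ∀ y, ‖ψ y‖ ≤ (Metric.closedBall (0 : E3) R).indicator (fun _ => S) y := by
    intro y
    rw [Real.norm_eq_abs]
    by_cases hy : y ∈ Metric.closedBall (0 : E3) R
    · rw [indicator_of_mem hy]; exact hS y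
    · rw [indicator_of_notMem hy, hR y (by simpa using hy), abs_zero]
  have hint : Integrable ((Metric.closedBall (0 : E3) R).indicator fun _ => S) volume :=
    (integrable_indicator_iff measurableSet_closedBall).2
      (integrableOn_const ((isCompact_closedBall (0 : E3) R).measure_lt_top.ne))
  have h := norm_integral_le_of_norm_le hint (ae_of_all _ hle)
  rw [Real.norm_eq_abs] at h
  refine h.trans (le_of_eq ?_)
  rw [integral_indicator_const S measurableSet_closedBall, volBall, smul_eq_mul, mul_comm]
  rfl

end Integrals

/-! ## Horizontal dilations -/

section Dilation

/-- The horizontal dilation `(y₀, y₁, y₂) ↦ (λy₀, λy₁, y₂)` as a continuous linear map. [folklore] -/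
def dilH (lam : ℝ) : E3 →L[ℝ] E3 :=
  (lam • ContinuousLinearMap.smulRight (EuclideanSpace.proj (0 : Fin 3) : E3 →L[ℝ] ℝ)
      (EuclideanSpace.single (0 : Fin 3) (1 : ℝ))) +
    (lam • ContinuousLinearMap.smulRight (EuclideanSpace.proj (1 : Fin 3) : E3 →L[ℝ] ℝ)
      (EuclideanSpace.single (1 : Fin 3) (1 : ℝ))) +
    ContinuousLinearMap.smulRight (EuclideanSpace.proj (2 : Fin 3) : E3 →L[ℝ] ℝ)
      (EuclideanSpace.single (2 : Fin 3) (1 : ℝ))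

/-- Coordinates of the horizontal dilation. [folklore] -/
theorem dilH_apply (lam : ℝ) (y : E3) :
    dilH lam y 0 = lam * y 0 ∧ dilH lam y 1 = lam * y 1 ∧ dilH lam y 2 = y 2 := by
  refine ⟨?_, ?_, ?_⟩ <;>
    simp [dilH, ContinuousLinearMap.smulRight_apply, mul_comm]

/-- `‖dilH λ‖ ≤ λ` for `λ ≥ 1`. [folklore] -/
theorem norm_dilH_le {lam : ℝ} (hlam : 1 ≤ lam) : ‖dilH lam‖ ≤ lam := by
  have hl0 : 0 ≤ lam := zero_le_one.trans hlam
  refine ContinuousLinearMap.opNorm_le_bound _ hl0 fun y => ?_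
  obtain ⟨h0, h1, h2⟩ := dilH_apply lam y
  have hsq : ‖dilH lam y‖ ^ 2 ≤ (lam * ‖y‖) ^ 2 := by
    rw [EuclideanSpace.norm_sq_eq, mul_pow, EuclideanSpace.norm_sq_eq, Fin.sum_univ_three,
      Fin.sum_univ_three, h0, h1, h2]
    simp only [Real.norm_eq_abs, sq_abs]
    have hl1 : 1 ≤ lam ^ 2 := by nlinarith
    nlinarith [sq_nonneg (y 0), sq_nonneg (y 1), sq_nonneg (y 2)]
  exact (pow_le_pow_iff_left₀ (norm_nonneg _) (by positivity) two_ne_zero).1 hsq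

/-- **Chain rule bound for horizontal dilations**: for smooth `g` and `λ ≥ 1`,
`‖Dᵏ(g ∘ dilH λ)(x)‖ ≤ λᵏ ‖Dᵏg(dilH λ x)‖`. [folklore] -/
theorem norm_iteratedFDeriv_comp_dilH_le {F : Type*} [NormedAddCommGroup F] [NormedSpace ℝ F]
    {g : E3 → F} (hg : ContDiff ℝ ∞ g) {lam : ℝ} (hlam : 1 ≤ lam) (k : ℕ) (x : E3) :
    ‖iteratedFDeriv ℝ k (fun y => g (dilH lam y)) x‖ ≤ lam ^ k * ‖iteratedFDeriv ℝ k g (dilH lam x)‖ := by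
  have h := (dilH lam).iteratedFDeriv_comp_right hg x (i := k) (natCast_le_infty k)
  rw [show (fun y => g (dilH lam y)) = g ∘ (dilH lam) from rfl, h]
  refine (ContinuousMultilinearMap.norm_compContinuousLinearMap_le _ _).trans ?_
  rw [Finset.prod_const, Finset.card_univ, Fintype.card_fin, mul_comm]
  gcongr
  exact norm_dilH_le hlam

end Dilation

/-- `‖Dg(x)(g x)‖ ≤ ‖D¹g(x)‖ ‖g(x)‖` for a field `g : ℝ³ → ℝ³`. [folklore] -/
theorem norm_fderiv_apply_self_le (g : E3 → E3) (x : E3) :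
    ‖fderiv ℝ g x (g x)‖ ≤ ‖iteratedFDeriv ℝ 1 g x‖ * ‖iteratedFDeriv ℝ 0 g x‖ := by
  rw [norm_iteratedFDeriv_one, norm_iteratedFDeriv_zero]
  exact (fderiv ℝ g x).le_opNorm (g x)

end Sep3

end Summit.NavierStokesRegularity.FunctionalMining

end
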